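import Summits.QuantumFields.YangMills.Theorems.SwapVirialDeficitZeroModeGroupFourSmallBallLogPrelim
import HarnessLib

/-!
# The PERIODIC massive-mode rung, brick PM-III: EXTRACTION of the middle-region two-scale bounds (upper)/(lower) of the log-squeeze lemma from the
# two-scale kernel factorisation `K_t(a₀, ρ) = 4π·ρ⁻¹·V(ρ, t/ρ²; a₀)` and a locally uniform two-scale LIMIT `V → M(a₀)`
# (free-hands support of ⟨stmt-QuantumFields-24196⟩ `SwapVirialDeficit.ToronSoftnessSharp`; contract (I1′)–(I3′) of LEAD ym-line-sfw-p2 g96's PM design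
# `sfw-p2-g96-memo-24196-PM-design.md` §2½ (board 13:28Z); feeds ✓`BlowUp.tendsto_div_log_of_twoScale` / ✓`BlowUpRing.periodicPrincipalLogLimit_of_twoScale`)

ABSTRACT in the kernel: `K : ℝ → ℝ × ℝ → ℝ≥0∞` (periodic rung: `K t = periodicKernel 0 1 t t²`), a two-scale fibre mass `V : ℝ → ℝ → ℝ → ℝ≥0∞` indexed by
`(u, s) = (ρ, t/ρ²)` and the hub real part `a₀` (LEAD g96's second blow-up `(m, l) = (ρ, ρ⁻¹)`, constant weight `4π`), a limit profile `M : ℝ → ℝ≥0∞` and a bound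
`Vmax < ∞`.  Hypotheses:
(I1′) `K t (a₀, ρ) = ofReal(4π)·ofReal ρ⁻¹·V ρ (t/ρ²) a₀` for `t, ρ > 0`, `a₀² + ρ² < 1`, and `= 0` for `a₀² + ρ² ≥ 1`;
(I2′) `V u s a₀ ≤ Vmax` for `0 < u ≤ 1`, `0 < s`, `|a₀| ≤ 1`; `M` measurable, `M ≤ Vmax`;
(I3′) `∀ ε > 0, ∀ r₀ ∈ (0,1), ∃ θ > 0, ∀ a₀ (r₀ ≤ |a₀| ≤ 1), ∀ u, s ∈ (0, θ): V u s a₀ ≤ M a₀ + ε` (upper) ∕ `M a₀ ≤ V u s a₀ + ε` (lower).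
Conclusions ★★★ `twoScale_upper` ∕ ★★★ `twoScale_lower` = LITERALLY (hupper)/(hlower) of ✓`BlowUp.tendsto_div_log_of_twoScale` (σ = Lebesgue on `ℝ ∋ a₀`) with
`gI := (∫⁻ a₀ in Ioo (−1) 1, ofReal(4π)·M a₀).toReal`; the middle region `A√t < ρ ≤ δ` with `δ = θ/2`, `A = θ^{−1/2}` gives `u = ρ < θ`, `s = t/ρ² < θ`; the cut
`|a₀| < r₀ = τ` (and, for the lower half, `|a₀| > 1 − τ`) costs `≤ 4π·(4τ·Vmax + 2τ)` of mass.
HONEST LABEL: one-variable real analysis (plumbing for a plan-level fixed-`L` rung of a DRAFT line); the two-scale limit (I3′) itself (PM-I/II, LEAD g96) is NOT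
proved here; ⟨24196⟩/⟨24497⟩ OPEN; own crux ⟨22884⟩ OPEN (blocked-on ⟨19935⟩); the Yang–Mills mass gap is NOT proved; no summit is proved by a line.
Width seat ym-line-sfw-p2-w3 g64 (cell ym-idea-1, free hands), `--supports stmt-QuantumFields-24196`.  THEOREMS ONLY (0 `def`, 0 `sorry`), standard axioms.
References: [cite: Luscher1983, §2]; [cite: GonzalezarroyoAltes1988]; [folklore].
-/

set_option autoImplicit false

noncomputable section

open MeasureTheory Set Filter Topology
open scoped ENNReal

namespace Summit.QuantumFields.YangMills.Theorems.SwapVirialDeficit.BlowUp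

open Summit.QuantumFields.YangMills.Theorems.SwapVirialDeficit.ZeroModeGroup (eventually_pos_lt)

/-! ## §1 Middle-region arithmetic and the cuts -/

/-- On the middle region `θ^{−1/2}·√t < ρ ≤ θ/2` (`0 < θ ≤ 1`, `t > 0`): `0 < ρ`, `ρ < θ`, `ρ ≤ 1`, `0 < t/ρ²`, `t/ρ² < θ`. [folklore] -/
theorem middle_us {θ t ρ : ℝ} (hθ : 0 < θ) (hθ1 : θ ≤ 1) (ht : 0 < t) (hρ : ρ ∈ Ioc (1 / Real.sqrt θ * Real.sqrt t) (θ / 2)) :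
    0 < ρ ∧ ρ < θ ∧ ρ ≤ 1 ∧ 0 < t / ρ ^ 2 ∧ t / ρ ^ 2 < θ := by
  have hsθ : 0 < Real.sqrt θ := Real.sqrt_pos.2 hθ
  have hst : 0 < Real.sqrt t := Real.sqrt_pos.2 ht
  have hlow : 1 / Real.sqrt θ * Real.sqrt t < ρ := hρ.1
  have hρ0 : 0 < ρ := lt_trans (by positivity) hlow
  refine ⟨hρ0, by linarith [hρ.2], by linarith [hρ.2], by positivity, ?_⟩
  -- `ρ > √t/√θ` ⟹ `ρ² > t/θ` ⟹ `t/ρ² < θ`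
  have h1 : Real.sqrt t / Real.sqrt θ < ρ := by rw [div_eq_mul_inv, mul_comm, ← one_div]; exact hlow
  have h2 : Real.sqrt t < ρ * Real.sqrt θ := by rwa [div_lt_iff₀ hsθ] at h1
  have h3 : t < ρ ^ 2 * θ := by
    have h4 : Real.sqrt t ^ 2 < (ρ * Real.sqrt θ) ^ 2 := by gcongr
    rw [Real.sq_sqrt ht.le, mul_pow, Real.sq_sqrt hθ.le] at h4; exact h4
  rw [div_lt_iff₀ (by positivity)]; linarith

/-- `vol(Ioo(−1,1) ∖ good) ≤ 4τ` for `good = {τ ≤ |a₀|} ∩ Icc (−(1−τ)) (1−τ)` (`0 ≤ τ`): the complement lies in three intervals of total length `4τ`. [folklore] -/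
theorem volume_Ioo_diff_good_le {τ : ℝ} (hτ : 0 ≤ τ) :
    (volume : Measure ℝ) (Ioo (-1 : ℝ) 1 \ ({a | τ ≤ |a|} ∩ Icc (-(1 - τ)) (1 - τ))) ≤ ENNReal.ofReal (4 * τ) := by
  have hsub : Ioo (-1 : ℝ) 1 \ ({a | τ ≤ |a|} ∩ Icc (-(1 - τ)) (1 - τ)) ⊆ Ioo (-τ) τ ∪ (Ioo (-1 : ℝ) (-(1 - τ)) ∪ Ioo (1 - τ) 1) := by
    intro a ha
    simp only [Set.mem_sdiff, Set.mem_Ioo, Set.mem_inter_iff, Set.mem_setOf_eq, Set.mem_Icc, not_and_or, not_le] at ha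
    obtain ⟨⟨h1, h2⟩, h⟩ := ha
    simp only [Set.mem_union, Set.mem_Ioo]
    rcases h with h | h | h
    · left; exact abs_lt.1 h
    · right; left; exact ⟨h1, h⟩
    · right; right; exact ⟨h, h2⟩
  calc (volume : Measure ℝ) (Ioo (-1 : ℝ) 1 \ ({a | τ ≤ |a|} ∩ Icc (-(1 - τ)) (1 - τ)))
      ≤ volume (Ioo (-τ) τ ∪ (Ioo (-1 : ℝ) (-(1 - τ)) ∪ Ioo (1 - τ) 1)) := measure_mono hsub
    _ ≤ volume (Ioo (-τ) τ) + (volume (Ioo (-1 : ℝ) (-(1 - τ))) + volume (Ioo (1 - τ) (1 : ℝ))) :=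
        (measure_union_le _ _).trans (add_le_add le_rfl (measure_union_le _ _))
    _ = ENNReal.ofReal (4 * τ) := by
        rw [Real.volume_Ioo, Real.volume_Ioo, Real.volume_Ioo, ← ENNReal.ofReal_add (by linarith) (by linarith),
          ← ENNReal.ofReal_add (by linarith) (by linarith)]
        congr 1; ring

/-- The mass budget: `ofReal(4π)·(Vmax·ofReal(4τ) + ofReal(2τ)) ≤ ofReal ε` for the choice `τ = min (1/2) (ε/(4π(4Vr+2)+1))`, `Vmax = ofReal Vr`. [folklore] -/
theorem mass_budget {ε Vr τ : ℝ} (hVr : 0 ≤ Vr) (hτ0 : 0 ≤ τ) (hτ : τ ≤ ε / (4 * Real.pi * (4 * Vr + 2) + 1)) :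
    ENNReal.ofReal (4 * Real.pi) * (ENNReal.ofReal Vr * ENNReal.ofReal (4 * τ) + ENNReal.ofReal (2 * τ)) ≤ ENNReal.ofReal ε := by
  have hπ : 0 < Real.pi := Real.pi_pos
  rw [← ENNReal.ofReal_mul hVr, ← ENNReal.ofReal_add (by positivity) (by positivity), ← ENNReal.ofReal_mul (by positivity)]
  refine ENNReal.ofReal_le_ofReal ?_
  have hD : 0 < 4 * Real.pi * (4 * Vr + 2) + 1 := by positivity
  have h1 : τ * (4 * Real.pi * (4 * Vr + 2) + 1) ≤ ε := by
    calc τ * (4 * Real.pi * (4 * Vr + 2) + 1) ≤ ε / (4 * Real.pi * (4 * Vr + 2) + 1) * (4 * Real.pi * (4 * Vr + 2) + 1) :=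
          mul_le_mul_of_nonneg_right hτ hD.le
      _ = ε := div_mul_cancel₀ _ hD.ne'
  nlinarith

/-! ## §2 The upper half -/

/-- ★★★ **(hupper) FROM THE TWO-SCALE LIMIT** (contract (I1′), (I2′), upper (I3′)). [cite: Luscher1983, §2] [cite: GonzalezarroyoAltes1988] -/
theorem twoScale_upper (K : ℝ → ℝ × ℝ → ℝ≥0∞) (V : ℝ → ℝ → ℝ → ℝ≥0∞) (M : ℝ → ℝ≥0∞) {Vmax : ℝ≥0∞} (hVmax : Vmax ≠ ∞)
    (hK : ∀ t a₀ ρ : ℝ, 0 < t → 0 < ρ → a₀ ^ 2 + ρ ^ 2 < 1 →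
      K t (a₀, ρ) = ENNReal.ofReal (4 * Real.pi) * ENNReal.ofReal ρ⁻¹ * V ρ (t / ρ ^ 2) a₀)
    (hK0 : ∀ t a₀ ρ : ℝ, 0 < t → 0 < ρ → 1 ≤ a₀ ^ 2 + ρ ^ 2 → K t (a₀, ρ) = 0)
    (hV : ∀ u s a₀ : ℝ, 0 < u → u ≤ 1 → 0 < s → |a₀| ≤ 1 → V u s a₀ ≤ Vmax) (hM : Measurable M) (hMV : ∀ a₀, M a₀ ≤ Vmax)
    (hup : ∀ ε : ℝ, 0 < ε → ∀ r₀ ∈ Ioo (0 : ℝ) 1, ∃ θ : ℝ, 0 < θ ∧ ∀ a₀ : ℝ, r₀ ≤ |a₀| → |a₀| ≤ 1 →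
      ∀ u ∈ Ioo (0 : ℝ) θ, ∀ s ∈ Ioo (0 : ℝ) θ, V u s a₀ ≤ M a₀ + ENNReal.ofReal ε)
    {ε : ℝ} (hε : 0 < ε) :
    ∃ A δ : ℝ, 0 < A ∧ 0 < δ ∧ ∃ G : ℝ → ℝ≥0∞,
      ∫⁻ x, G x ∂(volume : Measure ℝ) ≤ ENNReal.ofReal ((∫⁻ a₀ in Ioo (-1 : ℝ) 1, ENNReal.ofReal (4 * Real.pi) * M a₀ ∂volume).toReal + ε) ∧
      ∀ᶠ t in 𝓝[>] (0 : ℝ), ∀ a₀ : ℝ, ∀ ρ ∈ Ioc (A * Real.sqrt t) δ, K t (a₀, ρ) ≤ G a₀ * ENNReal.ofReal ρ⁻¹ := by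
  obtain ⟨Vr, hVr⟩ : ∃ x : ℝ, x = Vmax.toReal := ⟨_, rfl⟩
  have hVr0 : 0 ≤ Vr := by rw [hVr]; exact ENNReal.toReal_nonneg
  have hVmaxE : Vmax = ENNReal.ofReal Vr := by rw [hVr, ENNReal.ofReal_toReal hVmax]
  -- the cut
  set τ : ℝ := min (1 / 2) (ε / (4 * Real.pi * (4 * Vr + 2) + 1)) with hτdef
  have hτ0 : 0 < τ := lt_min (by norm_num) (div_pos hε (by positivity))
  have hτ1 : τ < 1 := lt_of_le_of_lt (min_le_left _ _) (by norm_num)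
  have hbudget := mass_budget (ε := ε) hVr0 hτ0.le (min_le_right _ _)
  obtain ⟨θ₀, hθ₀, hθV⟩ := hup τ hτ0 τ ⟨hτ0, hτ1⟩
  set θ : ℝ := min θ₀ 1 with hθdef
  have hθ : 0 < θ := lt_min hθ₀ one_pos
  have hθ1 : θ ≤ 1 := min_le_right _ _
  have hθθ₀ : θ ≤ θ₀ := min_le_left _ _
  -- the majorant
  set B : ℝ → ℝ≥0∞ := fun a₀ => if τ ≤ |a₀| then M a₀ else Vmax with hB
  set G : ℝ → ℝ≥0∞ := (Ioo (-1 : ℝ) 1).indicator fun a₀ => ENNReal.ofReal (4 * Real.pi) * (B a₀ + ENNReal.ofReal τ) with hG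
  refine ⟨1 / Real.sqrt θ, θ / 2, by positivity, by positivity, G, ?_, ?_⟩
  · -- mass of the majorant
    have hfin : ∫⁻ a₀ in Ioo (-1 : ℝ) 1, ENNReal.ofReal (4 * Real.pi) * M a₀ ∂volume ≠ ∞ := by
      refine ne_top_of_le_ne_top (b := ∫⁻ _a in Ioo (-1 : ℝ) 1, ENNReal.ofReal (4 * Real.pi) * Vmax ∂volume) ?_ (lintegral_mono fun a₀ => ?_)
      · rw [setLIntegral_const, Real.volume_Ioo]
        exact ENNReal.mul_ne_top (ENNReal.mul_ne_top ENNReal.ofReal_ne_top hVmax) ENNReal.ofReal_ne_top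
      · exact mul_le_mul' le_rfl (hMV a₀)
    rw [ENNReal.ofReal_add ENNReal.toReal_nonneg hε.le, ENNReal.ofReal_toReal hfin]
    -- pointwise `B ≤ M + 𝟙_{(−τ, τ)}·Vmax`
    have hBle : ∀ a₀, B a₀ ≤ M a₀ + (Ioo (-τ) τ).indicator (fun _ => Vmax) a₀ := by
      intro a₀
      simp only [hB]
      split_ifs with h
      · exact le_self_add
      · rw [Set.indicator_of_mem (show a₀ ∈ Ioo (-τ) τ from abs_lt.1 (not_le.1 h))]
        exact le_add_self
    have hmeasI : Measurable fun a₀ : ℝ => (Ioo (-τ) τ).indicator (fun _ => Vmax) a₀ := measurable_const.indicator measurableSet_Ioo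
    have hmeas2 : Measurable fun a₀ : ℝ => (Ioo (-τ) τ).indicator (fun _ => Vmax) a₀ + ENNReal.ofReal τ := hmeasI.add_const _
    calc ∫⁻ x, G x ∂(volume : Measure ℝ)
        = ∫⁻ a₀ in Ioo (-1 : ℝ) 1, ENNReal.ofReal (4 * Real.pi) * (B a₀ + ENNReal.ofReal τ) ∂volume := by
          rw [hG, lintegral_indicator measurableSet_Ioo]
      _ ≤ ∫⁻ a₀ in Ioo (-1 : ℝ) 1, ENNReal.ofReal (4 * Real.pi) * M a₀ +
            ENNReal.ofReal (4 * Real.pi) * ((Ioo (-τ) τ).indicator (fun _ => Vmax) a₀ + ENNReal.ofReal τ) ∂volume := by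
          refine lintegral_mono fun a₀ => ?_
          rw [← mul_add, ← add_assoc]
          exact mul_le_mul' le_rfl (add_le_add (hBle a₀) le_rfl)
      _ = (∫⁻ a₀ in Ioo (-1 : ℝ) 1, ENNReal.ofReal (4 * Real.pi) * M a₀ ∂volume) +
            ENNReal.ofReal (4 * Real.pi) * ((∫⁻ a₀ in Ioo (-1 : ℝ) 1, (Ioo (-τ) τ).indicator (fun _ => Vmax) a₀ ∂volume) +
              ENNReal.ofReal τ * volume (Ioo (-1 : ℝ) 1)) := by
          rw [lintegral_add_left ((hM.const_mul _)), lintegral_const_mul _ hmeas2, lintegral_add_left hmeasI, setLIntegral_const]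
      _ ≤ (∫⁻ a₀ in Ioo (-1 : ℝ) 1, ENNReal.ofReal (4 * Real.pi) * M a₀ ∂volume) +
            ENNReal.ofReal (4 * Real.pi) * (ENNReal.ofReal Vr * ENNReal.ofReal (4 * τ) + ENNReal.ofReal (2 * τ)) := by
          refine add_le_add le_rfl (mul_le_mul' le_rfl (add_le_add ?_ ?_))
          · calc ∫⁻ a₀ in Ioo (-1 : ℝ) 1, (Ioo (-τ) τ).indicator (fun _ => Vmax) a₀ ∂volume
                ≤ ∫⁻ a₀, (Ioo (-τ) τ).indicator (fun _ => Vmax) a₀ ∂volume := lintegral_mono' Measure.restrict_le_self le_rfl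
              _ = Vmax * volume (Ioo (-τ) τ) := lintegral_indicator_const measurableSet_Ioo _
              _ ≤ ENNReal.ofReal Vr * ENNReal.ofReal (4 * τ) := by
                  rw [hVmaxE, Real.volume_Ioo]
                  exact mul_le_mul' le_rfl (ENNReal.ofReal_le_ofReal (by linarith))
          · rw [Real.volume_Ioo, ← ENNReal.ofReal_mul hτ0.le]
            exact ENNReal.ofReal_le_ofReal (by linarith)
      _ ≤ _ := add_le_add le_rfl hbudget
  · -- the pointwise bound on the middle region
    filter_upwards [eventually_mem_nhdsWithin] with t ht a₀ ρ hρ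
    have ht0 : 0 < t := ht
    obtain ⟨hρ0, hρθ, hρ1, hs0, hsθ⟩ := middle_us hθ hθ1 ht0 hρ
    by_cases hin : a₀ ^ 2 + ρ ^ 2 < 1
    · have ha2 : a₀ ^ 2 < 1 := by nlinarith
      have ha1 : |a₀| < 1 := abs_lt.2 ⟨by nlinarith, by nlinarith⟩
      have hamem : a₀ ∈ Ioo (-1 : ℝ) 1 := abs_lt.1 ha1
      have hVB : V ρ (t / ρ ^ 2) a₀ ≤ B a₀ + ENNReal.ofReal τ := by
        by_cases hcut : τ ≤ |a₀|
        · have hBa : B a₀ = M a₀ := by simp only [hB, if_pos hcut]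
          rw [hBa]
          exact hθV a₀ hcut ha1.le ρ ⟨hρ0, hρθ.trans_le hθθ₀⟩ (t / ρ ^ 2) ⟨hs0, hsθ.trans_le hθθ₀⟩
        · have hBa : B a₀ = Vmax := by simp only [hB, if_neg hcut]
          rw [hBa]
          exact (hV ρ (t / ρ ^ 2) a₀ hρ0 hρ1 hs0 ha1.le).trans le_self_add
      rw [hK t a₀ ρ ht0 hρ0 hin]
      calc ENNReal.ofReal (4 * Real.pi) * ENNReal.ofReal ρ⁻¹ * V ρ (t / ρ ^ 2) a₀
          ≤ ENNReal.ofReal (4 * Real.pi) * ENNReal.ofReal ρ⁻¹ * (B a₀ + ENNReal.ofReal τ) := mul_le_mul' le_rfl hVB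
        _ = G a₀ * ENNReal.ofReal ρ⁻¹ := by rw [hG, Set.indicator_of_mem hamem]; ring
    · rw [hK0 t a₀ ρ ht0 hρ0 (not_lt.1 hin)]; exact bot_le

/-! ## §3 The lower half -/

/-- ★★★ **(hlower) FROM THE TWO-SCALE LIMIT** (contract (I1′) on `a₀² + ρ² < 1`, `M ≤ Vmax < ∞` measurable, lower (I3′)); minorant
`G′ = 𝟙_{τ ≤ |a₀| ≤ 1−τ}·4π·(M(a₀) ∸ τ)`, `δ = min (θ/2) τ`, `A = θ^{−1/2}`. [cite: Luscher1983, §2] [cite: GonzalezarroyoAltes1988] -/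
theorem twoScale_lower (K : ℝ → ℝ × ℝ → ℝ≥0∞) (V : ℝ → ℝ → ℝ → ℝ≥0∞) (M : ℝ → ℝ≥0∞) {Vmax : ℝ≥0∞} (hVmax : Vmax ≠ ∞)
    (hK : ∀ t a₀ ρ : ℝ, 0 < t → 0 < ρ → a₀ ^ 2 + ρ ^ 2 < 1 →
      K t (a₀, ρ) = ENNReal.ofReal (4 * Real.pi) * ENNReal.ofReal ρ⁻¹ * V ρ (t / ρ ^ 2) a₀)
    (hM : Measurable M) (hMV : ∀ a₀, M a₀ ≤ Vmax)
    (hlo : ∀ ε : ℝ, 0 < ε → ∀ r₀ ∈ Ioo (0 : ℝ) 1, ∃ θ : ℝ, 0 < θ ∧ ∀ a₀ : ℝ, r₀ ≤ |a₀| → |a₀| ≤ 1 →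
      ∀ u ∈ Ioo (0 : ℝ) θ, ∀ s ∈ Ioo (0 : ℝ) θ, M a₀ ≤ V u s a₀ + ENNReal.ofReal ε)
    {ε : ℝ} (hε : 0 < ε) :
    ∃ A δ : ℝ, 0 < A ∧ 0 < δ ∧ ∃ G : ℝ → ℝ≥0∞,
      ENNReal.ofReal ((∫⁻ a₀ in Ioo (-1 : ℝ) 1, ENNReal.ofReal (4 * Real.pi) * M a₀ ∂volume).toReal - ε) ≤ ∫⁻ x, G x ∂(volume : Measure ℝ) ∧
      ∀ᶠ t in 𝓝[>] (0 : ℝ), ∀ a₀ : ℝ, ∀ ρ ∈ Ioc (A * Real.sqrt t) δ, G a₀ * ENNReal.ofReal ρ⁻¹ ≤ K t (a₀, ρ) := by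
  obtain ⟨Vr, hVr⟩ : ∃ x : ℝ, x = Vmax.toReal := ⟨_, rfl⟩
  have hVr0 : 0 ≤ Vr := by rw [hVr]; exact ENNReal.toReal_nonneg
  have hVmaxE : Vmax = ENNReal.ofReal Vr := by rw [hVr, ENNReal.ofReal_toReal hVmax]
  set τ : ℝ := min (1 / 2) (ε / (4 * Real.pi * (4 * Vr + 2) + 1)) with hτdef
  have hτ0 : 0 < τ := lt_min (by norm_num) (div_pos hε (by positivity))
  have hτ1 : τ < 1 := lt_of_le_of_lt (min_le_left _ _) (by norm_num)
  have hbudget := mass_budget (ε := ε) hVr0 hτ0.le (min_le_right _ _)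
  obtain ⟨θ₀, hθ₀, hθV⟩ := hlo τ hτ0 τ ⟨hτ0, hτ1⟩
  set θ : ℝ := min θ₀ 1 with hθdef
  have hθ : 0 < θ := lt_min hθ₀ one_pos
  have hθ1 : θ ≤ 1 := min_le_right _ _
  have hθθ₀ : θ ≤ θ₀ := min_le_left _ _
  -- the good set and the minorant
  set good : Set ℝ := {a | τ ≤ |a|} ∩ Icc (-(1 - τ)) (1 - τ) with hgood
  have hgoodm : MeasurableSet good := (measurableSet_le measurable_const continuous_abs.measurable).inter measurableSet_Icc
  set G : ℝ → ℝ≥0∞ := good.indicator fun a₀ => ENNReal.ofReal (4 * Real.pi) * (M a₀ - ENNReal.ofReal τ) with hG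
  refine ⟨1 / Real.sqrt θ, min (θ / 2) τ, by positivity, lt_min (by positivity) hτ0, G, ?_, ?_⟩
  · -- mass of the minorant
    have hfin : ∫⁻ a₀ in Ioo (-1 : ℝ) 1, ENNReal.ofReal (4 * Real.pi) * M a₀ ∂volume ≠ ∞ := by
      refine ne_top_of_le_ne_top (b := ∫⁻ _a in Ioo (-1 : ℝ) 1, ENNReal.ofReal (4 * Real.pi) * Vmax ∂volume) ?_ (lintegral_mono fun a₀ => ?_)
      · rw [setLIntegral_const, Real.volume_Ioo]
        exact ENNReal.mul_ne_top (ENNReal.mul_ne_top ENNReal.ofReal_ne_top hVmax) ENNReal.ofReal_ne_top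
      · exact mul_le_mul' le_rfl (hMV a₀)
    rw [ENNReal.ofReal_sub _ hε.le, ENNReal.ofReal_toReal hfin]
    refine tsub_le_iff_right.2 ?_
    have hmeasG : Measurable fun a₀ => ENNReal.ofReal (4 * Real.pi) * (M a₀ - ENNReal.ofReal τ) := (hM.sub measurable_const).const_mul _
    -- split `Ioo (−1,1) ⊆ good ∪ (Ioo ∖ good)`
    have hsplit : ∫⁻ a₀ in Ioo (-1 : ℝ) 1, ENNReal.ofReal (4 * Real.pi) * M a₀ ∂volume ≤
        (∫⁻ a₀ in good, ENNReal.ofReal (4 * Real.pi) * M a₀ ∂volume) +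
          ∫⁻ a₀ in Ioo (-1 : ℝ) 1 \ good, ENNReal.ofReal (4 * Real.pi) * M a₀ ∂volume := by
      calc ∫⁻ a₀ in Ioo (-1 : ℝ) 1, ENNReal.ofReal (4 * Real.pi) * M a₀ ∂volume
          ≤ ∫⁻ a₀ in good ∪ (Ioo (-1 : ℝ) 1 \ good), ENNReal.ofReal (4 * Real.pi) * M a₀ ∂volume :=
            lintegral_mono_set (fun a ha => by by_cases h : a ∈ good; exacts [Or.inl h, Or.inr ⟨ha, h⟩])
        _ ≤ _ := lintegral_union_le _ _ _
    -- the bad part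
    have hbad : ∫⁻ a₀ in Ioo (-1 : ℝ) 1 \ good, ENNReal.ofReal (4 * Real.pi) * M a₀ ∂volume ≤
        ENNReal.ofReal (4 * Real.pi) * (ENNReal.ofReal Vr * ENNReal.ofReal (4 * τ)) := by
      calc ∫⁻ a₀ in Ioo (-1 : ℝ) 1 \ good, ENNReal.ofReal (4 * Real.pi) * M a₀ ∂volume
          ≤ ∫⁻ _a in Ioo (-1 : ℝ) 1 \ good, ENNReal.ofReal (4 * Real.pi) * Vmax ∂volume := lintegral_mono fun a₀ => mul_le_mul' le_rfl (hMV a₀)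
        _ = ENNReal.ofReal (4 * Real.pi) * (Vmax * volume (Ioo (-1 : ℝ) 1 \ good)) := by rw [setLIntegral_const, mul_assoc]
        _ ≤ _ := by
            rw [hVmaxE]
            exact mul_le_mul' le_rfl (mul_le_mul' le_rfl (by rw [hgood]; exact volume_Ioo_diff_good_le hτ0.le))
    -- the good part
    have hgoodvol : volume good ≤ ENNReal.ofReal 2 := by
      calc volume good ≤ volume (Icc (-(1 - τ)) (1 - τ)) := measure_mono Set.inter_subset_right
        _ = ENNReal.ofReal (1 - τ - -(1 - τ)) := Real.volume_Icc
        _ ≤ ENNReal.ofReal 2 := ENNReal.ofReal_le_ofReal (by linarith)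
    have hgoodle : ∫⁻ a₀ in good, ENNReal.ofReal (4 * Real.pi) * M a₀ ∂volume ≤
        (∫⁻ x, G x ∂(volume : Measure ℝ)) + ENNReal.ofReal (4 * Real.pi) * ENNReal.ofReal (2 * τ) := by
      calc ∫⁻ a₀ in good, ENNReal.ofReal (4 * Real.pi) * M a₀ ∂volume
          ≤ ∫⁻ a₀ in good, ENNReal.ofReal (4 * Real.pi) * (M a₀ - ENNReal.ofReal τ) + ENNReal.ofReal (4 * Real.pi) * ENNReal.ofReal τ ∂volume := by
            refine lintegral_mono fun a₀ => ?_
            rw [← mul_add]; exact mul_le_mul' le_rfl le_tsub_add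
        _ = (∫⁻ a₀ in good, ENNReal.ofReal (4 * Real.pi) * (M a₀ - ENNReal.ofReal τ) ∂volume) +
              ENNReal.ofReal (4 * Real.pi) * ENNReal.ofReal τ * volume good := by rw [lintegral_add_left hmeasG, setLIntegral_const]
        _ ≤ (∫⁻ x, G x ∂(volume : Measure ℝ)) + ENNReal.ofReal (4 * Real.pi) * ENNReal.ofReal τ * ENNReal.ofReal 2 := by
            rw [hG, lintegral_indicator hgoodm]
            exact add_le_add le_rfl (mul_le_mul' le_rfl hgoodvol)
        _ = _ := by rw [mul_assoc, ← ENNReal.ofReal_mul hτ0.le, mul_comm τ 2]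
    calc ∫⁻ a₀ in Ioo (-1 : ℝ) 1, ENNReal.ofReal (4 * Real.pi) * M a₀ ∂volume
        ≤ (∫⁻ x, G x ∂(volume : Measure ℝ)) + ENNReal.ofReal (4 * Real.pi) * ENNReal.ofReal (2 * τ) +
            ENNReal.ofReal (4 * Real.pi) * (ENNReal.ofReal Vr * ENNReal.ofReal (4 * τ)) := hsplit.trans (add_le_add hgoodle hbad)
      _ = (∫⁻ x, G x ∂(volume : Measure ℝ)) +
            ENNReal.ofReal (4 * Real.pi) * (ENNReal.ofReal Vr * ENNReal.ofReal (4 * τ) + ENNReal.ofReal (2 * τ)) := by ring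
      _ ≤ _ := add_le_add le_rfl hbudget
  · -- the pointwise bound on the middle region
    filter_upwards [eventually_mem_nhdsWithin] with t ht a₀ ρ hρ
    have ht0 : 0 < t := ht
    have hρ' : ρ ∈ Ioc (1 / Real.sqrt θ * Real.sqrt t) (θ / 2) := ⟨hρ.1, hρ.2.trans (min_le_left _ _)⟩
    have hρτ : ρ ≤ τ := hρ.2.trans (min_le_right _ _)
    obtain ⟨hρ0, hρθ, -, hs0, hsθ⟩ := middle_us hθ hθ1 ht0 hρ'
    by_cases ha : a₀ ∈ good
    · have hcut : τ ≤ |a₀| := ha.1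
      have ha1τ : |a₀| ≤ 1 - τ := abs_le.2 ⟨ha.2.1, ha.2.2⟩
      have hin : a₀ ^ 2 + ρ ^ 2 < 1 := by
        have h1 : |a₀| ^ 2 ≤ (1 - τ) ^ 2 := pow_le_pow_left₀ (abs_nonneg _) ha1τ 2
        have h2 : ρ ^ 2 ≤ τ ^ 2 := pow_le_pow_left₀ hρ0.le hρτ 2
        rw [sq_abs] at h1
        nlinarith
      have hVB : M a₀ - ENNReal.ofReal τ ≤ V ρ (t / ρ ^ 2) a₀ :=
        tsub_le_iff_right.2 (hθV a₀ hcut (by linarith) ρ ⟨hρ0, hρθ.trans_le hθθ₀⟩ (t / ρ ^ 2) ⟨hs0, hsθ.trans_le hθθ₀⟩)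
      rw [hK t a₀ ρ ht0 hρ0 hin]
      calc G a₀ * ENNReal.ofReal ρ⁻¹ = ENNReal.ofReal (4 * Real.pi) * ENNReal.ofReal ρ⁻¹ * (M a₀ - ENNReal.ofReal τ) := by
            rw [hG, Set.indicator_of_mem ha]; ring
        _ ≤ _ := mul_le_mul' le_rfl hVB
    · rw [hG, Set.indicator_of_notMem ha, zero_mul]; exact bot_le

end Summit.QuantumFields.YangMills.Theorems.SwapVirialDeficit.BlowUp

end
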